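import Summits.ResolutionOfSingularities.ResolutionOfSingularities.Theorems.EquisingularLiftEquisingularLiftNatSpecimenS10ConicUnobsOfIso
import Summits.ResolutionOfSingularities.ResolutionOfSingularities.Theorems.EquisingularLiftEquisingularLiftNatProjLinearAut
import HarnessLib

/-!
# [OURS · L1 W4.5(b) · EL♮(3) · WIDTH TABLE D3/D4 certificate currency, brick (L2)] EVERY CONIC PROJECTIVELY EQUIVALENT TO THE NORMAL FORM IS
# UNOBSTRUCTED: `DirStepUnobs ℙ²_k univ _ V₊((X₀X₁ + X₂²) ∘ B) _` for every invertible matrix `B`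

Cell `res-hironaka`, LADDER-RESOLUTION rung L (D-0089), slot W4.5(b), crux chain w45b: child crux **EL♮(3)** = stmt-ResolutionOfSingularities-20148.
WIDTH seat res-L1-w45b-iso-w4 g2 (D-0157 DOOR 1); sequel of D3-8 (✓ p657846 / p658550 / p660048) and of (L) (`…NatProjLinearAut`).
`--supports stmt-ResolutionOfSingularities-20148 --as helper`. OURS; NOT a statement of H. Hironaka's 2017 manuscript (nothing of [Hironaka2017] is
asserted); AI-written, and AI review is weaker than expert review. DEF-FREE; no `sorry`; standard axioms. EL♮(3) is NOT proved here; resolution of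
singularities in positive characteristic is NOT proved here (dimension 3 is Cossart–Piltant 2008/2009 in print); counted 0 toward the summit.

WHAT. ★★ `S10Conic.dirStepUnobs_conic_linearChange (k) [Field k] (B : Matrix (Fin 3) (Fin 3) k) (hB : IsUnit B.det) (hZ) :
DirStepUnobs ℙ²_k univ _ (V₊(aeval B.toMvPolynomial (X₀X₁ + X₂²))) hZ` — the normal-form certificate (D3-8) moved by the linear change of
coordinates `B` (Harris, Lecture 1: «projectively equivalent»): `φ '' V₊(F₀) = V₊(F₀ ∘ B)` for the automorphism `φ` of ℙ²_k attached to `B⁻¹` by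
`ProjLin.exists_iso_image_zeroLocus`, then `S10Conic.dirStepUnobs_conic_of_iso`. Over an algebraically closed field every smooth conic is `V₊(F₀ ∘ B)` for
some invertible `B` (Eisenbud, *Geometry of Syzygies* §6A: «any irreducible conic is obtained from this one by … a linear change of coordinates»); that
classification is NOT typed here — customers name their `B`.

References (index only): J. Harris, *Algebraic Geometry: A First Course* (1992), Lecture 1 p. 4 [cite: Harris1992]; D. Eisenbud, *The Geometry of
Syzygies* (2005), §6A [cite: Eisenbud2005].
-/

set_option linter.dupNamespace false

noncomputable section

-- `Proj`/`ProjectiveSpectrum` carrier coercions under `instances` transparency (as in the chain's other chart files).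
set_option backward.isDefEq.respectTransparency false

open CategoryTheory AlgebraicGeometry MvPolynomial

namespace Summit.ResolutionOfSingularities.ResolutionOfSingularities.Cruxes.EquisingularLiftNat.Sections

namespace S10Conic

open Literature.AlgebraicGeometry.Motives Literature.AlgebraicGeometry.ProjectiveSpace

variable (k : Type) [Field k]

attribute [local instance] MvPolynomial.gradedAlgebra

/-- ★★ **EVERY CONIC PROJECTIVELY EQUIVALENT TO `X₀X₁ + X₂²` IS UNOBSTRUCTED IN `ℙ²_k`.** For an invertible `B : Matrix (Fin 3) (Fin 3) k` and
any closedness witness `hZ`: `DirStepUnobs ℙ²_k univ _ V₊((X₀X₁ + X₂²) ∘ B) hZ`. [cite: Harris1992, Lecture 1 (p. 4)]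
[OURS · L1 W4.5b · EL♮(3) · D3-8/(L2); NOT a statement of the manuscript; counted 0] -/
theorem dirStepUnobs_conic_linearChange (B : Matrix (Fin 3) (Fin 3) k) (hB : IsUnit B.det)
    (hZ : IsClosed (SmoothHypersurface.zeroLocusClosed
      (aeval B.toMvPolynomial (X 0 * X 1 + X 2 ^ 2 : MvPolynomial (Fin 3) k)) : Set (Proj (MvPolynomial.homogeneousSubmodule (Fin 3) k)))) :
    DirStepUnobs (Proj (MvPolynomial.homogeneousSubmodule (Fin 3) k)) Set.univ isClosed_univ
      (SmoothHypersurface.zeroLocusClosed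
        (aeval B.toMvPolynomial (X 0 * X 1 + X 2 ^ 2 : MvPolynomial (Fin 3) k)) : Set (Proj (MvPolynomial.homogeneousSubmodule (Fin 3) k))) hZ := by
  classical
  haveI : IsIntegral (Proj (MvPolynomial.homogeneousSubmodule (Fin 3) k)) :=
    Literature.AlgebraicGeometry.Resolution.isIntegral_projectiveSpace 2 k
  have hB' : IsUnit B⁻¹.det := Matrix.isUnit_nonsing_inv_det_iff.2 hB
  -- the automorphism `φ` of `ℙ²` attached to `B⁻¹`: `φ '' V₊(G ∘ B⁻¹) = V₊(G)`; with `G := F₀ ∘ B`, `G ∘ B⁻¹ = F₀`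
  obtain ⟨φ, hφ⟩ := ProjLin.exists_iso_image_zeroLocus (n := 2) hB'
  have himage : (φ.hom : Proj (MvPolynomial.homogeneousSubmodule (Fin 3) k) → Proj (MvPolynomial.homogeneousSubmodule (Fin 3) k)) ''
      (SmoothHypersurface.zeroLocusClosed (X 0 * X 1 + X 2 ^ 2 : MvPolynomial (Fin 3) k) : Set _) =
      (SmoothHypersurface.zeroLocusClosed
        (aeval B.toMvPolynomial (X 0 * X 1 + X 2 ^ 2 : MvPolynomial (Fin 3) k)) : Set (Proj (MvPolynomial.homogeneousSubmodule (Fin 3) k))) := by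
    have h := hφ (aeval B.toMvPolynomial (X 0 * X 1 + X 2 ^ 2 : MvPolynomial (Fin 3) k))
    rw [aeval_toMvPolynomial_inv_right hB] at h
    rw [SmoothHypersurface.coe_zeroLocusClosed, SmoothHypersurface.coe_zeroLocusClosed]
    exact h
  have hc : IsClosed ((φ.hom : Proj (MvPolynomial.homogeneousSubmodule (Fin 3) k) → Proj (MvPolynomial.homogeneousSubmodule (Fin 3) k)) ''
      (SmoothHypersurface.zeroLocusClosed (X 0 * X 1 + X 2 ^ 2 : MvPolynomial (Fin 3) k) : Set _)) := by
    rw [himage]; exact hZ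
  exact (dirStepUnobs_congr_set himage).1 (dirStepUnobs_conic_of_iso k φ hc)

end S10Conic

end Summit.ResolutionOfSingularities.ResolutionOfSingularities.Cruxes.EquisingularLiftNat.Sections

end
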